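import Summits.ValiantsHypothesis.ValiantsHypothesis.Theorems.LacunarySymmetroidMatrixDescartesCensusDoorA34DefiniteEndLetterTwo

/-!
# `MatrixDescartes` census — DOOR A at `(3,4)`, flag ladder one size down: the `(2,3)` end-letter calculus on the OPEN side `d₂ < 2d₁` —
# the PLANE DICHOTOMY: correlated letters see at most THREE top-branch crossings

HONEST FRAMING.  Object-search cell `pub-symmetroid`, door-A seat `val-sym-door-p3` (g24); helper file `--supports` the OPEN typed statement
`Theses.LacunarySymmetroid.DoorA34 = PosRootLawAt 3 4 18` (stmt-ValiantsHypothesis-19980), asserted nowhere here.  Part 3 of the `(2,3)`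
definite-end-letter files (`…DefiniteEndLetterTwoCalculus`: the defect `ρ = T₀ + T₁xⁿ + √Q − 2/xᵃ` and its critical fewnomial;
`…DefiniteEndLetterTwo`: the law `≤ 4` for `d₂ > 2d₁`).  Claim L — the flag ladder's source question — is OPEN exactly on `d₂ < 2d₁` (chambers
III/IV), where a `(2,3)` definite-bottom row CAN cross its top branch five times (located, DOOR-A34-P3G7 §2).  The same machinery says WHICH rows can:
along `z = w³` the critical fewnomial is `A w^{6n} − κ w^{2a+4n} + B w^{3n} + C₀`, and for `n < a` (`d₂ = a + n < 2a = 2d₁`) the NEGATIVE monomial is the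
TOP one (`2a + 4n > 6n`), so with `B ≥ 0` there is only one sign change:

* `card_posRoots_criticalFewnomial_le_one` — `A, B, C₀ ≥ 0`, `n, m > 0`: `A w^{6n} − κ w^{6n+2m} + B w^{3n} + C₀` has at most ONE positive root;
* `critical_eq_two_false_of_lt`, **`rho_four_zeros_false_of_lt`** — for `0 < n < a`, `A, B, C₀ ≥ 0`, `B² ≤ 4AC₀`, `Q > 0` on `(0,∞)`: the defect
  has no FOUR zeros;
* **`no_four_psdSingular_of_correlated`** — THE PLANE DICHOTOMY (bottom letter `1`, `d₁ < d₂ < 2d₁`): if the traceless parts of `S₁, S₂` are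
  non-negatively Frobenius-correlated, `(S₁₀₀ − S₁₁₁)(S₂₀₀ − S₂₁₁) + 4 S₁₀₁S₂₀₁ ≥ 0` (this IS the sign of the linear coefficient `B` of the
  discriminant `Q`), then `1 + x^{d₁}S₁ + x^{d₂}S₂` has at most THREE positive PSD-singular points.  So on the open side five top-branch
  crossings REQUIRE anti-correlated letters (`⟨S₁⁰, S₂⁰⟩ < 0`: the eigenvalue gap of `S₁ + sS₂` first closes, an avoided crossing at `s > 0`).

READING for Claim L (chambers III/IV; paper, seat report DOOR-A34-P3G24-REPORT): for a `3 × 3` pencil `1 + x^{d₁}S₁ + x^{d₂}S₂` every `2 × 2`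
compression to a plane `W` is a `(2,3)` row of this file's shape (bottom letter `1_W`), and `λ_min` of the pencil is the minimum over `W` of the
compressed `λ_min`; a pure-λ_min NINE would force every plane through two of the top eigenvectors taken in the first four negativity windows to be
an ANTI-correlated plane carrying four or five crossings in prescribed windows — a magnitude constraint on the Grassmannian that the root-local
incidence package of DOOR-A34-P3G23 §3b does not contain.  Nothing here bounds `ζ_sym(3,3)` or `ζ_sym(3,4)`; `DoorA34`, Claim L on `d₂ < 2d₁` and
`MatrixDescartes` (stmt-ValiantsHypothesis-18050) stay OPEN; nothing on `VP ≠ VNP`.  [folklore] Rolle's theorem, Descartes' rule; the seat lineage's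
argument (DOOR-A34-P3G7 §2b) read on the other side of `d₂ = 2d₁`.
-/

set_option linter.dupNamespace false

namespace Summit.ValiantsHypothesis.ValiantsHypothesis.Theorems.LacunarySymmetroidMatrixDescartes.Census

namespace EndLetterTwo

open Polynomial Finset Set
open scoped BigOperators Polynomial Matrix

/-! ## 7. CHAMBERS III/IV (`d₂ < 2d₁`): the PLANE DICHOTOMY — correlated letters see at most three top-branch crossings -/

/-- The Descartes step for `n < a`: the fewnomial `A·w^{6n} − κ·w^{6n+2m} + B·w^{3n} + C₀` with `A, B, C₀ ≥ 0` (any `κ`) has at most ONE positive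
root (the top monomial is the only negative one: `P/w^{6n+2m}` is strictly decreasing). [folklore] -/
theorem card_posRoots_criticalFewnomial_le_one (A B C₀ κ : ℝ) {n m : ℕ} (hn : 0 < n) (hm : 0 < m)
    (hA : 0 ≤ A) (hB : 0 ≤ B) (hC : 0 ≤ C₀)
    (hP : (∑ t : Fin 4, C ((![A, -κ, B, C₀] : Fin 4 → ℝ) t)
        * X ^ ((![6 * n, 6 * n + 2 * m, 3 * n, 0] : Fin 4 → ℕ) t)) ≠ 0) :
    ((∑ t : Fin 4, C ((![A, -κ, B, C₀] : Fin 4 → ℝ) t)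
        * X ^ ((![6 * n, 6 * n + 2 * m, 3 * n, 0] : Fin 4 → ℕ) t)).roots.toFinset.filter
        (fun x => 0 < x)).card ≤ 1 := by
  by_contra h
  push Not at h
  obtain ⟨w₁, hw₁, w₂, hw₂, hne⟩ := Finset.one_lt_card.mp h
  rw [Finset.mem_filter, Multiset.mem_toFinset, mem_roots hP, IsRoot.def] at hw₁ hw₂
  simp only [Fin.sum_univ_four, eval_add, eval_mul, eval_C,
    eval_pow, eval_X, Matrix.cons_val_zero, Matrix.cons_val_one, Matrix.cons_val_two, Matrix.cons_val, Matrix.vecHead, Matrix.vecTail,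
    Function.comp_apply, Fin.succ_zero_eq_one, pow_zero, mul_one] at hw₁ hw₂
  -- WLOG by symmetry: derive A = B = C₀ = 0 from the two root equations
  have key : ∀ u v : ℝ, 0 < u → u < v →
      A * u ^ (6 * n) + -κ * u ^ (6 * n + 2 * m) + B * u ^ (3 * n) + C₀ = 0 →
      A * v ^ (6 * n) + -κ * v ^ (6 * n + 2 * m) + B * v ^ (3 * n) + C₀ = 0 → A = 0 ∧ B = 0 ∧ C₀ = 0 := by
    intro u v hu huv e₁ e₂
    have hv : 0 < v := hu.trans huv
    have id : A * (u ^ (6 * n) * v ^ (6 * n)) * (v ^ (2 * m) - u ^ (2 * m))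
        + B * (u ^ (3 * n) * v ^ (3 * n)) * (v ^ (3 * n + 2 * m) - u ^ (3 * n + 2 * m))
        + C₀ * (v ^ (6 * n + 2 * m) - u ^ (6 * n + 2 * m)) = 0 := by
      have := congrArg₂ (fun p q : ℝ => p * v ^ (6 * n + 2 * m) - q * u ^ (6 * n + 2 * m)) e₁ e₂
      simp only [zero_mul, sub_zero] at this
      rw [← this]; ring
    have p1 : 0 < v ^ (2 * m) - u ^ (2 * m) := sub_pos.mpr (pow_lt_pow_left₀ huv hu.le (by omega))
    have p2 : 0 < v ^ (3 * n + 2 * m) - u ^ (3 * n + 2 * m) := sub_pos.mpr (pow_lt_pow_left₀ huv hu.le (by omega))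
    have p3 : 0 < v ^ (6 * n + 2 * m) - u ^ (6 * n + 2 * m) := sub_pos.mpr (pow_lt_pow_left₀ huv hu.le (by omega))
    have q1 : 0 ≤ A * (u ^ (6 * n) * v ^ (6 * n)) * (v ^ (2 * m) - u ^ (2 * m)) := by positivity
    have q2 : 0 ≤ B * (u ^ (3 * n) * v ^ (3 * n)) * (v ^ (3 * n + 2 * m) - u ^ (3 * n + 2 * m)) := by positivity
    have q3 : 0 ≤ C₀ * (v ^ (6 * n + 2 * m) - u ^ (6 * n + 2 * m)) := by positivity
    have z1 : A * (u ^ (6 * n) * v ^ (6 * n)) * (v ^ (2 * m) - u ^ (2 * m)) = 0 := by linarith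
    have z2 : B * (u ^ (3 * n) * v ^ (3 * n)) * (v ^ (3 * n + 2 * m) - u ^ (3 * n + 2 * m)) = 0 := by linarith
    have z3 : C₀ * (v ^ (6 * n + 2 * m) - u ^ (6 * n + 2 * m)) = 0 := by linarith
    refine ⟨?_, ?_, ?_⟩
    · rcases mul_eq_zero.mp z1 with h | h
      · rcases mul_eq_zero.mp h with h' | h'
        · exact h'
        · exact absurd h' (by positivity)
      · exact absurd h p1.ne'
    · rcases mul_eq_zero.mp z2 with h | h
      · rcases mul_eq_zero.mp h with h' | h'
        · exact h'
        · exact absurd h' (by positivity)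
      · exact absurd h p2.ne'
    · rcases mul_eq_zero.mp z3 with h | h
      · exact h
      · exact absurd h p3.ne'
  obtain ⟨hA0, hB0, hC0⟩ : A = 0 ∧ B = 0 ∧ C₀ = 0 := by
    rcases lt_or_gt_of_ne hne with hlt | hlt
    · exact key w₁ w₂ hw₁.2 hlt hw₁.1 hw₂.1
    · exact key w₂ w₁ hw₂.2 hlt hw₂.1 hw₁.1
  -- then κ w₁^{6n+2m} = 0 forces κ = 0 and P = 0
  have hκ0 : κ = 0 := by
    have e := hw₁.1
    rw [hA0, hB0, hC0] at e
    have : κ * w₁ ^ (6 * n + 2 * m) = 0 := by linarith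
    rcases mul_eq_zero.mp this with h' | h'
    · exact h'
    · exact absurd h' (pow_ne_zero _ hw₁.2.ne')
  apply hP
  simp only [Fin.sum_univ_four, Matrix.cons_val_zero, Matrix.cons_val_one, Matrix.cons_val_two, Matrix.cons_val, Matrix.vecHead,
    Matrix.vecTail, Function.comp_apply, Fin.succ_zero_eq_one, hA0, hB0, hC0, hκ0, neg_zero, map_zero, zero_mul, add_zero]

/-- **Two critical points are impossible for `n < a` when `B ≥ 0`.**  With `0 < n < a`, `A, B, C₀ ≥ 0`, `B² ≤ 4AC₀` and `Q(z₀) > 0`, the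
critical equation `n⁴Δ²·z^{2a+4n} = 64a²(a+n)²·Q(z)³` has at most one positive solution (along `z = w³`:
`card_posRoots_criticalFewnomial_le_one`). [folklore] -/
theorem critical_eq_two_false_of_lt (A B C₀ : ℝ) {a n : ℕ} (hn : 0 < n) (hna : n < a) (hA : 0 ≤ A) (hB : 0 ≤ B) (hC : 0 ≤ C₀)
    (hΔ : B ^ 2 ≤ 4 * A * C₀) {z : Fin 2 → ℝ} (hz0 : 0 < z 0) (hz : StrictMono z)
    (hQ : 0 < A * z 0 ^ (2 * n) + B * z 0 ^ n + C₀)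
    (hcrit : ∀ j, (n : ℝ) ^ 4 * (B ^ 2 - 4 * A * C₀) ^ 2 * z j ^ (2 * a + 4 * n)
      = 64 * (a : ℝ) ^ 2 * ((a : ℝ) + n) ^ 2 * (A * z j ^ (2 * n) + B * z j ^ n + C₀) ^ 3) : False := by
  obtain ⟨m, hm, rfl⟩ : ∃ m, 0 < m ∧ a = n + m := ⟨a - n, by omega, by omega⟩
  have hzpos : ∀ j, 0 < z j := fun j => lt_of_lt_of_le hz0 (hz.monotone (Fin.zero_le j))
  have ha0 : (0 : ℝ) < ((n + m : ℕ) : ℝ) := by positivity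
  have hden : 0 < 64 * ((n + m : ℕ) : ℝ) ^ 2 * (((n + m : ℕ) : ℝ) + n) ^ 2 := by positivity
  set κ₀ : ℝ := (n : ℝ) ^ 4 * (B ^ 2 - 4 * A * C₀) ^ 2 / (64 * ((n + m : ℕ) : ℝ) ^ 2 * (((n + m : ℕ) : ℝ) + n) ^ 2) with hκ₀
  have hκ₀nn : 0 ≤ κ₀ := by positivity
  set w : Fin 2 → ℝ := fun j => (z j) ^ ((((3 : ℕ) : ℝ))⁻¹) with hw
  have hw3 : ∀ j, w j ^ 3 = z j := fun j => Real.rpow_inv_natCast_pow (hzpos j).le (by norm_num)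
  have hwpos : ∀ j, 0 < w j := fun j => Real.rpow_pos_of_pos (hzpos j) _
  have hwmono : StrictMono w := fun i j hij =>
    Real.rpow_lt_rpow (hzpos i).le (hz hij) (by positivity)
  set κ : ℝ := κ₀ ^ ((((3 : ℕ) : ℝ))⁻¹) with hκ
  have hκ3 : κ ^ 3 = κ₀ := Real.rpow_inv_natCast_pow hκ₀nn (by norm_num)
  have hroot : ∀ j, A * w j ^ (6 * n) + B * w j ^ (3 * n) + C₀ = κ * w j ^ (6 * n + 2 * m) := by
    intro j
    have hQw : A * z j ^ (2 * n) + B * z j ^ n + C₀ = A * w j ^ (6 * n) + B * w j ^ (3 * n) + C₀ := by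
      rw [← hw3 j, ← pow_mul, ← pow_mul]
      congr 3; ring
    have he : 2 * (n + m) + 4 * n = 3 * (2 * n) + 2 * m := by ring
    have hwe : (w j ^ (6 * n + 2 * m)) ^ 3 = z j ^ (2 * (n + m) + 4 * n) := by
      rw [← pow_mul, mul_comm, pow_mul, hw3 j]; congr 1; ring
    have hcube : (A * w j ^ (6 * n) + B * w j ^ (3 * n) + C₀) ^ 3 = (κ * w j ^ (6 * n + 2 * m)) ^ 3 := by
      rw [mul_pow, hκ3, ← hQw, hwe, hκ₀, div_mul_eq_mul_div, eq_div_iff hden.ne', hcrit j]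
      ring
    exact (Odd.strictMono_pow (by decide : Odd 3)).injective hcube
  set P : ℝ[X] := ∑ t : Fin 4, C ((![A, -κ, B, C₀] : Fin 4 → ℝ) t)
      * X ^ ((![6 * n, 6 * n + 2 * m, 3 * n, 0] : Fin 4 → ℕ) t) with hP
  have hPeval : ∀ j, P.eval (w j) = 0 := by
    intro j
    rw [hP, eval_finsetSum]
    simp only [Fin.sum_univ_four, eval_mul, eval_C, eval_pow, eval_X, Matrix.cons_val_zero, Matrix.cons_val_one,
      Matrix.cons_val_two, Matrix.cons_val, Matrix.vecHead, Matrix.vecTail, Function.comp_apply, Fin.succ_zero_eq_one,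
      pow_zero, mul_one]
    linear_combination hroot j
  have hP0 : P ≠ 0 := by
    intro h0
    have hc0 : P.coeff 0 = C₀ := by
      rw [hP, finsetSum_coeff]
      simp only [Fin.sum_univ_four, coeff_C_mul, coeff_X_pow, Matrix.cons_val_zero, Matrix.cons_val_one,
        Matrix.cons_val_two, Matrix.cons_val, Matrix.vecHead, Matrix.vecTail, Function.comp_apply, Fin.succ_zero_eq_one]
      have h1 : (0 : ℕ) ≠ 6 * n := by omega
      have h2 : (0 : ℕ) ≠ 6 * n + 2 * m := by omega
      have h3 : (0 : ℕ) ≠ 3 * n := by omega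
      simp [h1, h2, h3]
    have hc6 : P.coeff (6 * n) = A := by
      rw [hP, finsetSum_coeff]
      simp only [Fin.sum_univ_four, coeff_C_mul, coeff_X_pow, Matrix.cons_val_zero, Matrix.cons_val_one,
        Matrix.cons_val_two, Matrix.cons_val, Matrix.vecHead, Matrix.vecTail, Function.comp_apply, Fin.succ_zero_eq_one]
      have h3 : 6 * n ≠ 3 * n := by omega
      have h4 : 6 * n ≠ 0 := by omega
      simp [h3, h4, hm.ne']
    rw [h0, coeff_zero] at hc0 hc6
    have hB0 : B = 0 := by
      have : B ^ 2 ≤ 0 := by rw [← hc0, ← hc6] at hΔ; simpa using hΔ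
      exact pow_eq_zero_iff two_ne_zero |>.mp (le_antisymm this (sq_nonneg B))
    rw [← hc0, ← hc6, hB0] at hQ
    simp at hQ
  have hmem : ∀ j, w j ∈ P.roots.toFinset.filter (fun x => 0 < x) := fun j => by
    simp only [Finset.mem_filter, Multiset.mem_toFinset]
    exact ⟨(mem_roots hP0).mpr (hPeval j), hwpos j⟩
  have h01 : w 0 ≠ w 1 := (hwmono (by decide : (0 : Fin 2) < 1)).ne
  have hsub : ({w 0, w 1} : Finset ℝ) ⊆ P.roots.toFinset.filter (fun x => 0 < x) := by
    intro x hx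
    simp only [Finset.mem_insert, Finset.mem_singleton] at hx
    rcases hx with rfl | rfl <;> exact hmem _
  have hcard : ({w 0, w 1} : Finset ℝ).card = 2 := by
    rw [Finset.card_insert_of_notMem (by simp [h01]), Finset.card_singleton]
  have h2 := Finset.card_le_card hsub
  rw [hcard] at h2
  have h1 := card_posRoots_criticalFewnomial_le_one A B C₀ κ hn hm hA hB hC hP0
  rw [← hP] at h1
  omega

/-- **For `n < a` and `B ≥ 0` the defect has at most THREE zeros.**  `0 < n < a`, `A, B, C₀ ≥ 0`, `B² ≤ 4AC₀`, `Q > 0` on `(0,∞)`: the defect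
`T₀ + T₁xⁿ + √Q − 2/xᵃ` does not vanish at four points `0 < x₀ < x₁ < x₂ < x₃` (Rolle twice, then `critical_eq_two_false_of_lt`). [folklore] -/
theorem rho_four_zeros_false_of_lt (A B C₀ T₀ T₁ : ℝ) {a n : ℕ} (hn : 0 < n) (hna : n < a) (hA : 0 ≤ A) (hB : 0 ≤ B) (hC : 0 ≤ C₀)
    (hΔ : B ^ 2 ≤ 4 * A * C₀) (hQ : ∀ x : ℝ, 0 < x → 0 < A * x ^ (2 * n) + B * x ^ n + C₀)
    {x : Fin 4 → ℝ} (hx0 : 0 < x 0) (hx : StrictMono x)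
    (hroot : ∀ i, T₀ + T₁ * x i ^ n + Real.sqrt (A * x i ^ (2 * n) + B * x i ^ n + C₀) - 2 * (x i ^ a)⁻¹ = 0) : False := by
  have ha : 0 < a := hn.trans hna
  have hxpos : ∀ i, 0 < x i := fun i => lt_of_lt_of_le hx0 (hx.monotone (Fin.zero_le i))
  have hR1 : ∀ i : Fin 3, ∃ y, x i.castSucc < y ∧ y < x i.succ ∧
      T₁ * ((n : ℕ) * y ^ (n - 1))
        + (A * ((2 * n : ℕ) * y ^ (2 * n - 1)) + B * ((n : ℕ) * y ^ (n - 1)))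
            / (2 * Real.sqrt (A * y ^ (2 * n) + B * y ^ n + C₀))
        - 2 * (-((a : ℕ) * y ^ (a - 1)) / (y ^ a) ^ 2) = 0 := by
    intro i
    have hlt : x i.castSucc < x i.succ := hx (Fin.castSucc_lt_succ (i := i))
    have hpos : ∀ y ∈ Icc (x i.castSucc) (x i.succ), 0 < y := fun y hy => lt_of_lt_of_le (hxpos _) hy.1
    obtain ⟨c, hc, hc0⟩ := exists_hasDerivAt_eq_zero
      (f := fun t : ℝ => T₀ + T₁ * t ^ n + Real.sqrt (A * t ^ (2 * n) + B * t ^ n + C₀) - 2 * (t ^ a)⁻¹) hlt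
      (fun y hy => (hasDerivAt_rho A B C₀ T₀ T₁ a n (hpos y hy) (hQ y (hpos y hy))).continuousAt.continuousWithinAt)
      (by rw [hroot, hroot])
      (fun y hy => hasDerivAt_rho A B C₀ T₀ T₁ a n (hpos y (Ioo_subset_Icc_self hy)) (hQ y (hpos y (Ioo_subset_Icc_self hy))))
    exact ⟨c, hc.1, hc.2, hc0⟩
  choose y hy1 hy2 hy0 using hR1
  have hypos : ∀ i, 0 < y i := fun i => (hxpos _).trans (hy1 i)
  have hymono : StrictMono y := by
    refine Fin.strictMono_iff_lt_succ.mpr fun i => ?_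
    calc y i.castSucc < x i.castSucc.succ := hy2 _
      _ = x i.succ.castSucc := by rw [Fin.succ_castSucc]
      _ < y i.succ := hy1 _
  have hpsi : ∀ i, T₁ * n + n * (2 * A * y i ^ n + B) / (2 * Real.sqrt (A * y i ^ (2 * n) + B * y i ^ n + C₀))
      + 2 * a * (y i ^ (a + n))⁻¹ = 0 := by
    intro i
    have h := hy0 i
    rw [rho'_eq_pow_mul_psi A B C₀ T₁ ha hn (hypos i) (hQ _ (hypos i))] at h
    rcases mul_eq_zero.mp h with h' | h'
    · exact absurd h' (pow_ne_zero _ (hypos i).ne')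
    · exact h'
  have hR2 : ∀ j : Fin 2, ∃ z, y j.castSucc < z ∧ z < y j.succ ∧
      -((n : ℝ) ^ 2 * (B ^ 2 - 4 * A * C₀) / 4) * z ^ (n - 1)
          / ((A * z ^ (2 * n) + B * z ^ n + C₀) * Real.sqrt (A * z ^ (2 * n) + B * z ^ n + C₀))
        - 2 * a * (a + n) * (z ^ (a + n + 1))⁻¹ = 0 := by
    intro j
    have hlt : y j.castSucc < y j.succ := hymono (Fin.castSucc_lt_succ (i := j))
    have hpos : ∀ t ∈ Icc (y j.castSucc) (y j.succ), 0 < t := fun t ht => lt_of_lt_of_le (hypos _) ht.1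
    obtain ⟨c, hc, hc0⟩ := exists_hasDerivAt_eq_zero
      (f := fun t : ℝ => T₁ * n + n * (2 * A * t ^ n + B) / (2 * Real.sqrt (A * t ^ (2 * n) + B * t ^ n + C₀))
          + 2 * a * (t ^ (a + n))⁻¹) hlt
      (fun t ht => (hasDerivAt_psi A B C₀ T₁ ha hn (hpos t ht) (hQ t (hpos t ht))).continuousAt.continuousWithinAt)
      (by rw [hpsi, hpsi])
      (fun t ht => hasDerivAt_psi A B C₀ T₁ ha hn (hpos t (Ioo_subset_Icc_self ht)) (hQ t (hpos t (Ioo_subset_Icc_self ht))))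
    exact ⟨c, hc.1, hc.2, hc0⟩
  choose z hz1 hz2 hz0 using hR2
  have hzpos : ∀ j, 0 < z j := fun j => (hypos _).trans (hz1 j)
  have hzmono : StrictMono z := by
    refine Fin.strictMono_iff_lt_succ.mpr fun j => ?_
    calc z j.castSucc < y j.castSucc.succ := hz2 _
      _ = y j.succ.castSucc := by rw [Fin.succ_castSucc]
      _ < z j.succ := hz1 _
  have hcrit : ∀ j, (n : ℝ) ^ 4 * (B ^ 2 - 4 * A * C₀) ^ 2 * z j ^ (2 * a + 4 * n)
      = 64 * (a : ℝ) ^ 2 * ((a : ℝ) + n) ^ 2 * (A * z j ^ (2 * n) + B * z j ^ n + C₀) ^ 3 :=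
    fun j => critical_eq_of_psi'_eq_zero A B C₀ (hzpos j) (hQ _ (hzpos j)) (hz0 j) hn
  exact critical_eq_two_false_of_lt A B C₀ hn hna hA hB hC hΔ (hzpos 0) hzmono (hQ _ (hzpos 0)) hcrit

/-- **CHAMBER III/IV PLANE DICHOTOMY (bottom letter `1`).**  Let `F(x) = 1 + x^{d₁}S₁ + x^{d₂}S₂` be a real symmetric `2 × 2` three-letter pencil
with `d₁ < d₂ < 2d₁` (the `m = 2` shadow of Claim L's OPEN chambers III/IV).  If the traceless parts of the two upper letters are non-negatively
Frobenius-correlated — `(S₁₀₀ − S₁₁₁)(S₂₀₀ − S₂₁₁) + 4·S₁₀₁S₂₀₁ ≥ 0`, i.e. `2⟨S₁⁰, S₂⁰⟩ ≥ 0` — then `F` is positive semidefinite and singular at NO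
four points `0 < x₀ < x₁ < x₂ < x₃`: CORRELATED letters see at most THREE top-branch crossings; five (the Descartes maximum, located as
attained for `d₂ < 2d₁`) needs ANTI-correlated letters.  For a `3 × 3` pencil read through its `2 × 2` compressions `W`: every plane whose
compressed letters are correlated witnesses at most three PSD-singular points. [folklore] -/
theorem no_four_psdSingular_of_correlated (d : Fin 3 → ℕ) (S : Fin 3 → Matrix (Fin 2) (Fin 2) ℝ) (hS : ∀ l, (S l).IsSymm)
    (h0 : d 0 = 0) (hS0 : S 0 = 1) (hd1 : d 1 < d 2) (hd : d 2 < 2 * d 1)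
    (hcorr : 0 ≤ (S 1 0 0 - S 1 1 1) * (S 2 0 0 - S 2 1 1) + 4 * (S 1 0 1 * S 2 0 1))
    {x : Fin 4 → ℝ} (hx0 : 0 < x 0) (hx : StrictMono x)
    (hpsd : ∀ i, (∑ l, x i ^ d l • S l).PosSemidef) (hdet : ∀ i, (∑ l, x i ^ d l • S l).det = 0) : False := by
  obtain ⟨n, hn, hna, hd2⟩ : ∃ n, 0 < n ∧ n < d 1 ∧ d 2 = d 1 + n := ⟨d 2 - d 1, by omega, by omega, by omega⟩
  have hxpos : ∀ i, 0 < x i := fun i => lt_of_lt_of_le hx0 (hx.monotone (Fin.zero_le i))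
  have h₁ : S 1 1 0 = S 1 0 1 := (hS 1).apply 0 1
  have h₂ : S 2 1 0 = S 2 0 1 := (hS 2).apply 0 1
  have hroot : ∀ i, (-(S 1 0 0 + S 1 1 1)) + (-(S 2 0 0 + S 2 1 1)) * x i ^ n
      + Real.sqrt (((S 2 0 0 - S 2 1 1) ^ 2 + 4 * S 2 0 1 ^ 2) * x i ^ (2 * n)
          + (2 * ((S 1 0 0 - S 1 1 1) * (S 2 0 0 - S 2 1 1) + 4 * (S 1 0 1 * S 2 0 1))) * x i ^ n
          + ((S 1 0 0 - S 1 1 1) ^ 2 + 4 * S 1 0 1 ^ 2))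
      - 2 * (x i ^ d 1)⁻¹ = 0 := by
    intro i
    have hp := hpsd i
    have hdt := hdet i
    rw [pencil_eq_two d S h0 hS0, hd2] at hp hdt
    exact defect_eq_zero_of_psdSingular (S 1) (S 2) h₁ h₂ (d 1) n (hxpos i) hp hdt
  have hA : 0 ≤ (S 2 0 0 - S 2 1 1) ^ 2 + 4 * S 2 0 1 ^ 2 := by positivity
  have hC : 0 ≤ (S 1 0 0 - S 1 1 1) ^ 2 + 4 * S 1 0 1 ^ 2 := by positivity
  have hB : 0 ≤ 2 * ((S 1 0 0 - S 1 1 1) * (S 2 0 0 - S 2 1 1) + 4 * (S 1 0 1 * S 2 0 1)) := by linarith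
  have hΔ : (2 * ((S 1 0 0 - S 1 1 1) * (S 2 0 0 - S 2 1 1) + 4 * (S 1 0 1 * S 2 0 1))) ^ 2
      ≤ 4 * ((S 2 0 0 - S 2 1 1) ^ 2 + 4 * S 2 0 1 ^ 2) * ((S 1 0 0 - S 1 1 1) ^ 2 + 4 * S 1 0 1 ^ 2) := by
    nlinarith [sq_nonneg ((S 1 0 0 - S 1 1 1) * S 2 0 1 - S 1 0 1 * (S 2 0 0 - S 2 1 1))]
  by_cases hQ : ∀ t : ℝ, 0 < t → 0 < ((S 2 0 0 - S 2 1 1) ^ 2 + 4 * S 2 0 1 ^ 2) * t ^ (2 * n)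
      + (2 * ((S 1 0 0 - S 1 1 1) * (S 2 0 0 - S 2 1 1) + 4 * (S 1 0 1 * S 2 0 1))) * t ^ n
      + ((S 1 0 0 - S 1 1 1) ^ 2 + 4 * S 1 0 1 ^ 2)
  · exact rho_four_zeros_false_of_lt _ _ _ _ _ hn hna hA hB hC hΔ hQ hx0 hx hroot
  · push Not at hQ
    obtain ⟨t, ht, hQt⟩ := hQ
    have hsos : ∀ y : ℝ, ((S 2 0 0 - S 2 1 1) ^ 2 + 4 * S 2 0 1 ^ 2) * y ^ (2 * n)
        + (2 * ((S 1 0 0 - S 1 1 1) * (S 2 0 0 - S 2 1 1) + 4 * (S 1 0 1 * S 2 0 1))) * y ^ n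
        + ((S 1 0 0 - S 1 1 1) ^ 2 + 4 * S 1 0 1 ^ 2)
        = ((S 1 0 0 - S 1 1 1) + (S 2 0 0 - S 2 1 1) * y ^ n) ^ 2 + 4 * (S 1 0 1 + S 2 0 1 * y ^ n) ^ 2 := by
      intro y; ring
    rw [hsos] at hQt
    have hα : (S 1 0 0 - S 1 1 1) + (S 2 0 0 - S 2 1 1) * t ^ n = 0 := by nlinarith [sq_nonneg (S 1 0 1 + S 2 0 1 * t ^ n)]
    have hγ : S 1 0 1 + S 2 0 1 * t ^ n = 0 := by
      nlinarith [sq_nonneg ((S 1 0 0 - S 1 1 1) + (S 2 0 0 - S 2 1 1) * t ^ n)]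
    -- with correlation ≥ 0 this forces β = δ = 0, hence Q ≡ 0: the defect is a trinomial with ≤ 2 zeros
    have htn : 0 < t ^ n := pow_pos ht n
    have e1 : S 1 0 0 - S 1 1 1 = -((S 2 0 0 - S 2 1 1) * t ^ n) := by linarith
    have e2 : S 1 0 1 = -(S 2 0 1 * t ^ n) := by linarith
    have hsum : t ^ n * ((S 2 0 0 - S 2 1 1) ^ 2 + 4 * S 2 0 1 ^ 2) ≤ t ^ n * 0 := by
      have : t ^ n * ((S 2 0 0 - S 2 1 1) ^ 2 + 4 * S 2 0 1 ^ 2)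
          = -((S 1 0 0 - S 1 1 1) * (S 2 0 0 - S 2 1 1) + 4 * (S 1 0 1 * S 2 0 1)) := by rw [e1, e2]; ring
      rw [this, mul_zero]; linarith
    have hX : (S 2 0 0 - S 2 1 1) ^ 2 + 4 * S 2 0 1 ^ 2 ≤ 0 := le_of_mul_le_mul_left hsum htn
    have hβ : S 2 0 0 - S 2 1 1 = 0 :=
      pow_eq_zero_iff two_ne_zero |>.mp (le_antisymm (by nlinarith [sq_nonneg (S 2 0 1)]) (sq_nonneg _))
    have hδ : S 2 0 1 = 0 :=
      pow_eq_zero_iff two_ne_zero |>.mp (le_antisymm (by nlinarith [sq_nonneg (S 2 0 0 - S 2 1 1)]) (sq_nonneg _))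
    have hα0 : S 1 0 0 - S 1 1 1 = 0 := by rw [e1, hβ]; ring
    have hγ0 : S 1 0 1 = 0 := by rw [e2, hδ]; ring
    have hQ0 : ∀ y : ℝ, ((S 2 0 0 - S 2 1 1) ^ 2 + 4 * S 2 0 1 ^ 2) * y ^ (2 * n)
        + (2 * ((S 1 0 0 - S 1 1 1) * (S 2 0 0 - S 2 1 1) + 4 * (S 1 0 1 * S 2 0 1))) * y ^ n
        + ((S 1 0 0 - S 1 1 1) ^ 2 + 4 * S 1 0 1 ^ 2) = (0 * (y ^ n - 0)) ^ 2 := by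
      intro y; rw [hβ, hδ, hα0, hγ0]; ring
    -- reuse the decoupled lemma on five points? only four here: go through the trinomial directly
    have hne : (C (-2) * X ^ 0 + C (-(S 1 0 0 + S 1 1 1)) * X ^ d 1 + C (-(S 2 0 0 + S 2 1 1)) * X ^ (d 1 + n) : ℝ[X]) ≠ 0 := by
      intro h0'
      have hc := congrArg (fun P : ℝ[X] => P.coeff 0) h0'
      have h1 : (0 : ℕ) ≠ d 1 := by omega
      have h2 : (0 : ℕ) ≠ d 1 + n := by omega
      simp [coeff_X_pow, h1, h2] at hc
    have hmem : ∀ i, x i ∈ (C (-2) * X ^ 0 + C (-(S 1 0 0 + S 1 1 1)) * X ^ d 1 + C (-(S 2 0 0 + S 2 1 1)) * X ^ (d 1 + n) :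
        ℝ[X]).roots.toFinset.filter (fun t => 0 < t) := by
      intro i
      have h := hroot i
      rw [hQ0, Real.sqrt_sq_eq_abs] at h
      simp only [zero_mul, abs_zero, add_zero] at h
      have hxa : x i ^ d 1 ≠ 0 := pow_ne_zero _ (hxpos i).ne'
      simp only [Finset.mem_filter, Multiset.mem_toFinset, mem_roots hne, IsRoot.def, eval_add, eval_mul, eval_C, eval_pow, eval_X]
      refine ⟨?_, hxpos i⟩
      field_simp at h
      rw [pow_add]
      linear_combination h
    have hsub : Finset.univ.image x ⊆ (C (-2) * X ^ 0 + C (-(S 1 0 0 + S 1 1 1)) * X ^ d 1 + C (-(S 2 0 0 + S 2 1 1)) * X ^ (d 1 + n) :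
        ℝ[X]).roots.toFinset.filter (fun t => 0 < t) := by
      intro t ht'
      obtain ⟨i, -, rfl⟩ := Finset.mem_image.mp ht'
      exact hmem i
    have hcard : (Finset.univ.image x).card = 4 := by
      rw [Finset.card_image_of_injective _ hx.injective, Finset.card_univ, Fintype.card_fin]
    have h4 := Finset.card_le_card hsub
    rw [hcard] at h4
    have h2 := Census.card_posRoots_trinomial_le_two 0 (d 1) (d 1 + n) (-2) (-(S 1 0 0 + S 1 1 1)) (-(S 2 0 0 + S 2 1 1)) hne
    omega

end EndLetterTwo

end Summit.ValiantsHypothesis.ValiantsHypothesis.Theorems.LacunarySymmetroidMatrixDescartes.Census
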